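import Summits.ResolutionOfSingularities.ResolutionOfSingularities.Theses.FrobeniusLadder
import Summits.ResolutionOfSingularities.ResolutionOfSingularities.Theorems.FrobeniusLadderFRationalResolutionGradeZeroWeaklyFRegular
import HarnessLib

/-!
# Crux `FrobeniusLadder.FRationalResolution` (stmt-ResolutionOfSingularities-15317), line `redirect` —
# `stub_diagonalizableQuotientResolution` (char `p`, regular DOMAIN charts) is implied by the CRUX

Kill-criterion bookkeeping, sharper than leafhand-1's `…RedirectStubsOfSummit.lean` (stub ⟸ summit):
by `…GradeZeroWeaklyFRegular.lean` an integral `X/k`, `char k = p`, presented by étale charts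
`Spec S₀ → X` with `S` a regular DOMAIN of finite type graded by a finite abelian group has weakly
F-regular — in particular F-rational — stalks, so `X` is ITS OWN F-rational model (`π = 𝟙 X`) and the
crux `FRationalResolution` BY NAME resolves it:

* `fRationalClause_stalk_of_regularDomainCharts` — the crux's inline F-rational stalk clause
  (parameter ideals tightly closed) for such `X`, from the all-ideals clause;
* `stub_diagonalizableQuotientResolution_of_crux_of_domainCharts` — `FRationalResolution →` (the stub
  with its binders verbatim, restricted to `CharP k p` and DOMAIN charts).

Honest label: bookkeeping (the stub restricted to characteristic `p` and domain charts is ≤ the crux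
it serves; its characteristic-`0` instances are ≤ `Hironaka1964`, leafhand-1 p807646). No definitions,
no named facts, no sorry. [folklore; cite: HochsterHuneke1990, Prop. 4.12]
-/

noncomputable section

-- single-problem summit: the doubled namespace component is forced
set_option linter.dupNamespace false

open CategoryTheory AlgebraicGeometry
open Literature.AlgebraicGeometry.Resolution

namespace Summit.ResolutionOfSingularities.ResolutionOfSingularities.Theorems.FRationalResolution.DiagQuotientOfCrux

/-- **The crux's F-rational stalk clause for diagonalizable quotient singularities with regular
domain charts** (characteristic `p`): every stalk is a domain whose parameter ideals are tightly
closed — indeed all ideals are (`GradeZeroWeaklyFRegular.weaklyFRegular_stalk_of_regularDomainCharts`).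
[cite: HochsterHuneke1990, Prop. 4.12] -/
theorem fRationalClause_stalk_of_regularDomainCharts (p : ℕ) [Fact p.Prime] (k : Type) [Field k]
    [CharP k p] (X : Scheme.{0}) (g : X ⟶ Spec (.of k)) [IsIntegral X]
    (hq : ∀ x : X, ∃ (A : Type) (_ : AddCommGroup A) (_ : Finite A) (_ : DecidableEq A)
        (S : Type) (_ : CommRing S) (_ : Algebra k S) (𝒮 : A → Submodule k S)
        (_ : GradedAlgebra 𝒮), Algebra.FiniteType k S ∧ IsRegularRing S ∧ IsDomain S ∧
        ∃ φ : Spec (.of (𝒮 0)) ⟶ X, Etale φ ∧ x ∈ Set.range φ ∧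
          φ ≫ g = Spec.map (CommRingCat.ofHom (algebraMap k (𝒮 0))))
    (x : X) :
    IsDomain (X.presheaf.stalk x) ∧ ∀ d : ℕ, ringKrullDim (X.presheaf.stalk x) = d →
      ∀ s : Fin d → X.presheaf.stalk x, (Ideal.span (Set.range s)).radical.IsMaximal →
      ∀ y c : X.presheaf.stalk x, c ≠ 0 →
      (∀ e : ℕ, c * y ^ p ^ e ∈ Ideal.span ((fun z : X.presheaf.stalk x => z ^ p ^ e) ''
        (Ideal.span (Set.range s) : Set (X.presheaf.stalk x)))) → y ∈ Ideal.span (Set.range s) := by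
  obtain ⟨hdom, hcl⟩ := GradeZeroWeaklyFRegular.weaklyFRegular_stalk_of_regularDomainCharts p k X g hq x
  exact ⟨hdom, fun _ _ s _ y c hc hmem => hcl _ y c hc hmem⟩

/-- **`stub_diagonalizableQuotientResolution` — in characteristic `p`, for regular DOMAIN charts — is
implied by the crux `FRationalResolution` BY NAME**: such an `X` is its own F-rational model (the
identity is proper and birational, and its stalks satisfy the crux's clause by
`fRationalClause_stalk_of_regularDomainCharts`), so the crux resolves it. The stub's binders are
carried verbatim (`IsSeparated`, `LocallyOfFiniteType`, `QuasiCompact`, `IsIntegral`), plus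
`CharP k p` and `IsDomain S` in the charts. [folklore] -/
theorem stub_diagonalizableQuotientResolution_of_crux_of_domainCharts
    (hcrux : Summit.ResolutionOfSingularities.ResolutionOfSingularities.Theses.FrobeniusLadder.FRationalResolution)
    (p : ℕ) (hp : p.Prime) (k : Type) [Field k] [CharP k p] (X : Scheme.{0})
    (g : X ⟶ Spec (.of k)) [IsIntegral X] [IsSeparated g] [LocallyOfFiniteType g] [QuasiCompact g]
    (hq : ∀ x : X, ∃ (A : Type) (_ : AddCommGroup A) (_ : Finite A) (_ : DecidableEq A)
        (S : Type) (_ : CommRing S) (_ : Algebra k S) (𝒮 : A → Submodule k S)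
        (_ : GradedAlgebra 𝒮), Algebra.FiniteType k S ∧ IsRegularRing S ∧ IsDomain S ∧
        ∃ φ : Spec (.of (𝒮 0)) ⟶ X, Etale φ ∧ x ∈ Set.range φ ∧
          φ ≫ g = Spec.map (CommRingCat.ofHom (algebraMap k (𝒮 0)))) :
    Scheme.HasResolution X := by
  haveI : Fact p.Prime := ⟨hp⟩
  have hbir : IsBirational (𝟙 X) := ⟨⊤, by simp [dense_univ], by simp [dense_univ], inferInstance⟩
  exact hcrux p hp k X g inferInstance inferInstance inferInstance inferInstance
    ⟨X, 𝟙 X, inferInstance, hbir, fRationalClause_stalk_of_regularDomainCharts p k X g hq⟩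

end Summit.ResolutionOfSingularities.ResolutionOfSingularities.Theorems.FRationalResolution.DiagQuotientOfCrux

end
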